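import Mathlib
import HarnessLib
import Summits.HubbardSuperconductivity.HubbardSuperconductivity.Theorems.KLProgrammeCutCurrencyLegMassEight
import Summits.HubbardSuperconductivity.HubbardSuperconductivity.Theorems.KLProgrammeCutCurrencyFirstMomentNumeric
import Summits.HubbardSuperconductivity.HubbardSuperconductivity.Theorems.KLProgrammeKLRegimeEngineScaleWtSliceRows

/-!
# Route `KLProgramme` — ENGINE (stmt-HubbardSuperconductivity-20437 `KLRegimeEngineV17F2`), located #25 «(b)-PLAIN-UV-TAIL», cure (α),
# E1 item (i) IN BINDER #6's CURRENCY: the `klScaleWt_n`-WEIGHTED plain pinned currency of the UV-cut BARE VERTEX at the vertex pattern is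
# `≤ (|U|/24)·(8⁴ + 2Λ_n·8·20000·8³)` UNIFORMLY in `128 ≤ β ≤ M`, every scale `n` (cell gate-hubbard-kl, seat hubbard-kl-k3c2-p2 g35)

Binder #6 (`hplainE1cut` of `A24a1G14.stub_engine_step_norms_of_E1data₃LBcut56`) weighs `‖W₄(S_ĝ 𝒱ₙ)(x′)‖` by
`klScaleWt L M β n ((univ.image x′).image (x ↦ ((2x₀ : ZMod 4M), x⃗))) = 1 + Λ_n·diam_d(…)`, `d = gridLabelDist L (4M) β`.  On the support of the bare vertex's
kernel (spatially coincident tuples) that diameter is a TIME diameter: `≤ 2·Σ_i (β/2M)·d_{2M}(t′_i − t′_q)` (`klct_labelDiam_latticeImage_le`; the `4M`-grid doubles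
lattice times, `klct_cyclicDist_latticeTime_eq_cycDist`).  Hence (**`klbv_scaleWtCurrency_uvCut_hubbardInteraction_le`**) for `128 ≤ β ≤ M`, all `n`, `L`, `U`, `q`, `y`:

  `ε_x³ Σ_{x′ : x′_q = y} klScaleWt_n(x′)·‖W₄(S_ĝ V)(x′)‖ ≤ (|U|/24)·(8⁴ + 2·klScale klE0 n·(8·20000·8³))`

— the O(U) (bare-vertex) part of binder #6's weighted cut plain row at the vertex pattern, β- and `M`-uniform (unweighted part ✓-farm `…LegMassEight`, first-moment part
✓-farm `…WeightedCurrency` with `A ≤ 8`, `M₁ ≤ 20000`).  What remains for binder #6 proper: all label strings `τ′` (antisymmetry of `kernel V 4`), and `𝒱ₙ − V` (the loop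
corrections = the genuine E1 analysis).  No definition; nothing asserts any row, (b), (C), K3, U₀, the window or superconductivity.
References: BGM 2006 §2.3 (2.17), §3 [cite: BenfattoGiulianiMastropietro2006].
-/

noncomputable section

namespace Summit.HubbardSuperconductivity.HubbardSuperconductivity.Theorems.KLRegimeSplit

set_option linter.dupNamespace false -- summit = problem name (single-conjunct summit), D-0017

open Finset Literature.MathematicalPhysics.QuantumLattice Literature.Probability.LatticeModels GrassmannAlgebra
open Literature.Probability.LatticeModels.BattleFederbush
open Summit.HubbardSuperconductivity.HubbardSuperconductivity.Theorems.EngineV8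
open Summit.HubbardSuperconductivity.HubbardSuperconductivity.Theorems.KLProgrammeLegKernels

variable {L M : ℕ} [NeZero L] [NeZero M]

/-! ## §1 The `4M`-grid time distance of two lattice times is the `ℤ_{2M}` index distance -/

omit [NeZero L] in
/-- **Bridge**: `cyclicDist (4M) (2t) (2s) = 2·d_{2M}(t − s)` with `d_{2M}(a) = min(a, 2M − a)` the `Fin (2M)` index distance. -/
theorem klct_cyclicDist_latticeTime_eq_cycDist (t s : ImagTimeIdx M) :
    cyclicDist (2 * (2 * M)) (((2 * (t : ℕ) : ℕ) : ZMod (2 * (2 * M)))) (((2 * (s : ℕ) : ℕ) : ZMod (2 * (2 * M)))) =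
      2 * min ((((t - s : ImagTimeIdx M)) : ℕ) : ℝ) (((2 * M : ℕ) : ℝ) - (((t - s : ImagTimeIdx M)) : ℕ)) := by
  haveI : NeZero (2 * M) := ⟨by have := NeZero.ne M; omega⟩
  haveI : NeZero (1 : ℕ) := ⟨one_ne_zero⟩
  have hs := s.isLt
  have hkey := cyclicDist_latticeTime_eq (L := 1) ((t, (0 : TorusSite 2 1))) ((s, (0 : TorusSite 2 1)))
  simp only at hkey
  rw [hkey]
  congr 1
  -- `val (↑t − ↑s : ZMod 2M) = val (t − s : Fin 2M)`
  have hsub : (((t : ℕ) : ZMod (2 * M)) - ((s : ℕ) : ZMod (2 * M))) = (((((2 * M - (s : ℕ)) + (t : ℕ) : ℕ)) : ZMod (2 * M))) := by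
    rw [Nat.cast_add, Nat.cast_sub hs.le, ZMod.natCast_self]
    ring
  have hval : ((((t : ℕ) : ZMod (2 * M)) - ((s : ℕ) : ZMod (2 * M)))).val = (((t - s : ImagTimeIdx M)) : ℕ) := by
    rw [hsub, ZMod.val_natCast, Fin.val_sub]
  rw [← Int.cast_abs, ← Nat.cast_natAbs, ZMod.valMinAbs_natAbs_eq_min, hval, Nat.cast_min, Nat.cast_sub (t - s : ImagTimeIdx M).isLt.le]

/-! ## §2 The tree weight's diameter on a spatially coincident tuple -/

/-- **The `4M`-grid diameter of a spatially coincident position tuple is a time diameter**: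
`diam_d((univ.image x).image emb) ≤ 2·Σ_i (β/2M)·d_{2M}(t_i − t_q)` (`0 ≤ β`; all `x⃗_i` equal). -/
theorem klct_labelDiam_latticeImage_le {β : ℝ} (hβ : 0 ≤ β) (x : Fin 4 → SpaceTimeIdx L M) (q : Fin 4) (hsp : ∀ i, (x i).2 = (x q).2) :
    labelDiam (gridLabelDist L (2 * (2 * M)) β) ((univ.image x).image (fun z : SpaceTimeIdx L M => (((((2 * (z.1 : ℕ) : ℕ)) : ZMod (2 * (2 * M)))), z.2))) ≤
      2 * ∑ i : Fin 4, β / ((2 * M : ℕ) : ℝ) * min (((((x i).1 - (x q).1 : ImagTimeIdx M)) : ℕ) : ℝ) (((2 * M : ℕ) : ℝ) - ((((x i).1 - (x q).1 : ImagTimeIdx M)) : ℕ)) := by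
  classical
  haveI : NeZero (2 * (2 * M)) := ⟨by have := NeZero.ne M; omega⟩
  have hd := isLabelDist_gridLabelDist L (2 * (2 * M)) hβ
  have hN : (0 : ℝ) < ((2 * M : ℕ) : ℝ) := by have := NeZero.ne M; exact_mod_cast (by omega : 0 < 2 * M)
  -- the distance from leg `i` to the pinned leg
  set D : Fin 4 → ℝ := fun i => β / ((2 * M : ℕ) : ℝ) * min (((((x i).1 - (x q).1 : ImagTimeIdx M)) : ℕ) : ℝ) (((2 * M : ℕ) : ℝ) - ((((x i).1 - (x q).1 : ImagTimeIdx M)) : ℕ)) with hD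
  have hD0 : ∀ i, 0 ≤ D i := fun i => mul_nonneg (div_nonneg hβ hN.le) (klct_cycDist_nonneg _)
  have hdist : ∀ i, gridLabelDist L (2 * (2 * M)) β (((((2 * ((x i).1 : ℕ) : ℕ)) : ZMod (2 * (2 * M)))), (x i).2)
      (((((2 * ((x q).1 : ℕ) : ℕ)) : ZMod (2 * (2 * M)))), (x q).2) = D i := by
    intro i
    rw [gridLabelDist_apply]
    dsimp only
    rw [hsp i, (isLabelDist_torusSiteDist (L := L) (d := 2)).self, add_zero, klct_cyclicDist_latticeTime_eq_cycDist]
    simp only [hD]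
    push_cast
    ring
  refine labelDiam_le _ (mul_nonneg (by norm_num) (Finset.sum_nonneg (fun i _ => hD0 i))) (fun a ha b hb => ?_)
  obtain ⟨za, hza, rfl⟩ := Finset.mem_image.mp ha
  obtain ⟨ia, _, rfl⟩ := Finset.mem_image.mp hza
  obtain ⟨zb, hzb, rfl⟩ := Finset.mem_image.mp hb
  obtain ⟨ib, _, rfl⟩ := Finset.mem_image.mp hzb
  calc _ ≤ gridLabelDist L (2 * (2 * M)) β (((((2 * ((x ia).1 : ℕ) : ℕ)) : ZMod (2 * (2 * M)))), (x ia).2) (((((2 * ((x q).1 : ℕ) : ℕ)) : ZMod (2 * (2 * M)))), (x q).2) +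
          gridLabelDist L (2 * (2 * M)) β (((((2 * ((x q).1 : ℕ) : ℕ)) : ZMod (2 * (2 * M)))), (x q).2) (((((2 * ((x ib).1 : ℕ) : ℕ)) : ZMod (2 * (2 * M)))), (x ib).2) :=
        hd.triangle _ _ _
    _ = D ia + D ib := by rw [hdist ia, hd.symm, hdist ib]
    _ ≤ ∑ i : Fin 4, D i + ∑ i : Fin 4, D i :=
        add_le_add (Finset.single_le_sum (fun i _ => hD0 i) (Finset.mem_univ ia)) (Finset.single_le_sum (fun i _ => hD0 i) (Finset.mem_univ ib))
    _ = _ := by ring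

/-! ## §3 The `klScaleWt`-weighted cut plain currency of the bare vertex -/

/-- **The weight comparison on the kernel's support**: for every position tuple `x`,
`klScaleWt_n(S(x))·‖W₄(S_ĝV)(x)‖ ≤ (1 + 2Λ_n Σ_i (β/2M) d_{2M}(t_i − t_q))·‖W₄(S_ĝV)(x)‖` (off spatial coincidence the kernel vanishes; on it §2 applies). -/
theorem klct_scaleWt_mul_norm_le {β : ℝ} (hβ : 0 ≤ β) (n : ℕ) (U : ℝ) (q : Fin 4) (x : Fin 4 → SpaceTimeIdx L M) :
    klScaleWt L M β n ((univ.image x).image (fun z : SpaceTimeIdx L M => (((((2 * (z.1 : ℕ) : ℕ)) : ZMod (2 * (2 * M)))), z.2))) *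
        ‖sectorisedKernel L M β (trivialMultiplier L M)
          (ExteriorAlgebra.map (LinearMap.mulLeft ℂ (fun K : HubbardFieldIdx L M => ((gnScaleCutoff 4 klE0 1 |matsubaraFreq β M K.1.1.1| : ℝ) : ℂ))) (hubbardInteraction L M β U)) 4
          (![(((0 : Fin 1), (0 : Fin 2)), (0 : Fin 2)), ((0, 0), 1), ((0, 1), 0), ((0, 1), 1)] : Fin 4 → SectorLeg 1) x‖ ≤
      (1 + 2 * klScale klE0 n * ∑ i : Fin 4, β / ((2 * M : ℕ) : ℝ) *
          min (((((x i).1 - (x q).1 : ImagTimeIdx M)) : ℕ) : ℝ) (((2 * M : ℕ) : ℝ) - ((((x i).1 - (x q).1 : ImagTimeIdx M)) : ℕ))) *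
        ‖sectorisedKernel L M β (trivialMultiplier L M)
          (ExteriorAlgebra.map (LinearMap.mulLeft ℂ (fun K : HubbardFieldIdx L M => ((gnScaleCutoff 4 klE0 1 |matsubaraFreq β M K.1.1.1| : ℝ) : ℂ))) (hubbardInteraction L M β U)) 4
          (![(((0 : Fin 1), (0 : Fin 2)), (0 : Fin 2)), ((0, 0), 1), ((0, 1), 0), ((0, 1), 1)] : Fin 4 → SectorLeg 1) x‖ := by
  have hΛ : 0 ≤ klScale klE0 n := (klth_klScale_pos n).le
  by_cases hco : (x 0).2 = (x 3).2 ∧ (x 1).2 = (x 3).2 ∧ (x 2).2 = (x 3).2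
  · -- spatially coincident: compare the weights
    refine mul_le_mul_of_nonneg_right ?_ (norm_nonneg _)
    rw [klScaleWt_apply]
    have hsp : ∀ i, (x i).2 = (x q).2 := by
      obtain ⟨h0, h1, h2⟩ := hco
      have h3 : ∀ i, (x i).2 = (x 3).2 := by
        intro i; fin_cases i
        · exact h0
        · exact h1
        · exact h2
        · rfl
      intro i; rw [h3 i, h3 q]
    have := klct_labelDiam_latticeImage_le hβ x q hsp
    nlinarith
  · -- off the support the kernel vanishes
    have hzero : sectorisedKernel L M β (trivialMultiplier L M)
        (ExteriorAlgebra.map (LinearMap.mulLeft ℂ (fun K : HubbardFieldIdx L M => ((gnScaleCutoff 4 klE0 1 |matsubaraFreq β M K.1.1.1| : ℝ) : ℂ))) (hubbardInteraction L M β U)) 4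
        (![(((0 : Fin 1), (0 : Fin 2)), (0 : Fin 2)), ((0, 0), 1), ((0, 1), 0), ((0, 1), 1)] : Fin 4 → SectorLeg 1) x = 0 := by
      rw [klbv_sectorisedKernel_uvCut_hubbardInteraction_eq]
      have hker := klbv_positionKernel_hubbardInteraction_freqMul_eq β U (fun i : MatsubaraIdx M => (((gnScaleCutoff 4 klE0 1 |matsubaraFreq β M i| : ℝ) : ℂ))) x
      rw [hker, if_neg hco, mul_zero, mul_zero]
    rw [hzero, norm_zero, mul_zero, mul_zero]

/-- **E1 ITEM (i) IN BINDER #6's CURRENCY — THE `klScaleWt_n`-WEIGHTED CUT PLAIN CURRENCY OF THE BARE VERTEX, UNIFORMLY** (`128 ≤ β ≤ M`, every scale `n`,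
torus `L`, coupling `U`, pinned leg `q`, pin `y`):
`ε_x³ Σ_{x′ : x′_q = y} klScaleWt_n((univ.image x′).image emb)·‖W₄(S_ĝ V)(x′)‖ ≤ (|U|/24)·(8⁴ + 2·klScale klE0 n·(8·20000·8³))`. -/
theorem klbv_scaleWtCurrency_uvCut_hubbardInteraction_le {β : ℝ} (hβ : 128 ≤ β) (hM : β ≤ M) (n : ℕ) (U : ℝ) (q : Fin 4) (y : SpaceTimeIdx L M) :
    imagTimeWeight β M ^ 3 *
        ∑ x ∈ univ.filter (fun x : Fin 4 → SpaceTimeIdx L M => x q = y),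
          klScaleWt L M β n ((univ.image x).image (fun z : SpaceTimeIdx L M => (((((2 * (z.1 : ℕ) : ℕ)) : ZMod (2 * (2 * M)))), z.2))) *
          ‖sectorisedKernel L M β (trivialMultiplier L M)
            (ExteriorAlgebra.map (LinearMap.mulLeft ℂ (fun K : HubbardFieldIdx L M => ((gnScaleCutoff 4 klE0 1 |matsubaraFreq β M K.1.1.1| : ℝ) : ℂ))) (hubbardInteraction L M β U)) 4
            (![(((0 : Fin 1), (0 : Fin 2)), (0 : Fin 2)), ((0, 0), 1), ((0, 1), 0), ((0, 1), 1)] : Fin 4 → SectorLeg 1) x‖ ≤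
      |U| / 24 * (8 ^ 4 + 2 * klScale klE0 n * (8 * 20000 * 8 ^ 3)) := by
  have hβ0 : 0 < β := by linarith
  have hΛ : 0 ≤ klScale klE0 n := (klth_klScale_pos n).le
  have hε : 0 ≤ imagTimeWeight β M ^ 3 := by rw [imagTimeWeight]; positivity
  -- pointwise weight comparison, summed
  have hsum := Finset.sum_le_sum (fun x (_ : x ∈ univ.filter (fun x : Fin 4 → SpaceTimeIdx L M => x q = y)) => klct_scaleWt_mul_norm_le hβ0.le n U q x)
  refine (mul_le_mul_of_nonneg_left hsum hε).trans ?_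
  -- split into the unweighted and the first-moment currencies
  simp_rw [add_mul, one_mul, Finset.sum_add_distrib, mul_add]
  have h1 := klbv_plainCurrency_uvCut_hubbardInteraction_le_sharp hβ hM U q y
  have h2 := klbv_firstMomentCurrency_uvCut_hubbardInteraction_le (by linarith : (2 : ℝ) ≤ β) hM U q y
  have hA := klct_legMass_uvCut_le_eight hβ hM
  have hM₁ := klct_legFirstMoment_uvCut_le_numeric hβ hM
  have hA0 : 0 ≤ (((2 * M : ℕ) : ℝ))⁻¹ * ∑ j : ImagTimeIdx M, ‖∑ n : MatsubaraIdx M, (((gnScaleCutoff 4 klE0 1 |matsubaraFreq β M n| : ℝ) : ℂ)) *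
      Complex.exp (-((2 * Real.pi * ((n : ℕ) : ℝ) * ((j : ℕ) : ℝ) / (2 * M) : ℝ) : ℂ) * Complex.I)‖ :=
    mul_nonneg (inv_nonneg.mpr (by positivity)) (Finset.sum_nonneg (fun _ _ => norm_nonneg _))
  have hM₁0 : 0 ≤ (((2 * M : ℕ) : ℝ))⁻¹ * ∑ j : ImagTimeIdx M, (β * min ((j : ℕ) : ℝ) (((2 * M : ℕ) : ℝ) - (j : ℕ)) / ((2 * M : ℕ) : ℝ)) *
        ‖∑ n : MatsubaraIdx M, (((gnScaleCutoff 4 klE0 1 |matsubaraFreq β M n| : ℝ) : ℂ)) *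
          Complex.exp (-((2 * Real.pi * ((n : ℕ) : ℝ) * ((j : ℕ) : ℝ) / (2 * M) : ℝ) : ℂ) * Complex.I)‖ :=
    mul_nonneg (inv_nonneg.mpr (by positivity)) (Finset.sum_nonneg (fun j _ =>
      mul_nonneg (div_nonneg (mul_nonneg hβ0.le (klct_cycDist_nonneg j)) (by positivity)) (norm_nonneg _)))
  have h2' : imagTimeWeight β M ^ 3 *
        ∑ x ∈ univ.filter (fun x : Fin 4 → SpaceTimeIdx L M => x q = y),
          (∑ i : Fin 4, β / ((2 * M : ℕ) : ℝ) * min (((((x i).1 - (x q).1 : ImagTimeIdx M)) : ℕ) : ℝ) (((2 * M : ℕ) : ℝ) - ((((x i).1 - (x q).1 : ImagTimeIdx M)) : ℕ))) *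
          ‖sectorisedKernel L M β (trivialMultiplier L M)
            (ExteriorAlgebra.map (LinearMap.mulLeft ℂ (fun K : HubbardFieldIdx L M => ((gnScaleCutoff 4 klE0 1 |matsubaraFreq β M K.1.1.1| : ℝ) : ℂ))) (hubbardInteraction L M β U)) 4
            (![(((0 : Fin 1), (0 : Fin 2)), (0 : Fin 2)), ((0, 0), 1), ((0, 1), 0), ((0, 1), 1)] : Fin 4 → SectorLeg 1) x‖ ≤ |U| / 24 * (8 * 20000 * 8 ^ 3) := by
    refine h2.trans ?_
    gcongr
  -- the weighted term: pull the constant `2Λ_n` out of the sum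
  have hpull : imagTimeWeight β M ^ 3 *
        ∑ x ∈ univ.filter (fun x : Fin 4 → SpaceTimeIdx L M => x q = y),
          2 * klScale klE0 n * (∑ i : Fin 4, β / ((2 * M : ℕ) : ℝ) * min (((((x i).1 - (x q).1 : ImagTimeIdx M)) : ℕ) : ℝ) (((2 * M : ℕ) : ℝ) - ((((x i).1 - (x q).1 : ImagTimeIdx M)) : ℕ))) *
          ‖sectorisedKernel L M β (trivialMultiplier L M)
            (ExteriorAlgebra.map (LinearMap.mulLeft ℂ (fun K : HubbardFieldIdx L M => ((gnScaleCutoff 4 klE0 1 |matsubaraFreq β M K.1.1.1| : ℝ) : ℂ))) (hubbardInteraction L M β U)) 4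
            (![(((0 : Fin 1), (0 : Fin 2)), (0 : Fin 2)), ((0, 0), 1), ((0, 1), 0), ((0, 1), 1)] : Fin 4 → SectorLeg 1) x‖ =
      2 * klScale klE0 n * (imagTimeWeight β M ^ 3 *
        ∑ x ∈ univ.filter (fun x : Fin 4 → SpaceTimeIdx L M => x q = y),
          (∑ i : Fin 4, β / ((2 * M : ℕ) : ℝ) * min (((((x i).1 - (x q).1 : ImagTimeIdx M)) : ℕ) : ℝ) (((2 * M : ℕ) : ℝ) - ((((x i).1 - (x q).1 : ImagTimeIdx M)) : ℕ))) *
          ‖sectorisedKernel L M β (trivialMultiplier L M)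
            (ExteriorAlgebra.map (LinearMap.mulLeft ℂ (fun K : HubbardFieldIdx L M => ((gnScaleCutoff 4 klE0 1 |matsubaraFreq β M K.1.1.1| : ℝ) : ℂ))) (hubbardInteraction L M β U)) 4
            (![(((0 : Fin 1), (0 : Fin 2)), (0 : Fin 2)), ((0, 0), 1), ((0, 1), 0), ((0, 1), 1)] : Fin 4 → SectorLeg 1) x‖) := by
    rw [Finset.mul_sum, Finset.mul_sum, Finset.mul_sum]
    exact Finset.sum_congr rfl (fun x _ => by ring)
  rw [hpull]
  have hw := mul_le_mul_of_nonneg_left h2' (mul_nonneg (by norm_num : (0:ℝ) ≤ 2) hΛ)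
  nlinarith [h1, hw, abs_nonneg U]

end Summit.HubbardSuperconductivity.HubbardSuperconductivity.Theorems.KLRegimeSplit

end
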